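import Summits.BirchSwinnertonDyer.BirchSwinnertonDyer.Theorems.ByReductionTypeAtTwoMultTowerClass96330ba
import Summits.BirchSwinnertonDyer.BirchSwinnertonDyer.Theorems.ByReductionTypeAtTwoMultKatoNonsplitDescent
import HarnessLib

/-!
# M1 ADD-ONS (NON-SPLIT multiplicative `2`), module `NSB08` — descent-keyed displays for 1 tower classes / 2 layer pairs

Cell `bsd-2adic` (run/shared/lean/pub/bsd-2adic/), seat `bsd-2adic-mult` GEN 12, planner spec INBOX 2026-08-27T03:34–03:51Z /
04:52:45Z (exemplars `plan/m1/M1AddOnExemplar100342a.draft.lean`, `plan/m1/M1SAddOnExemplar101626s.draft.lean`). For each member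
`<lab>` below and each certified layer pair `(j,J)` of the class file `ByReductionTypeAtTwoMultTowerClass<cls>.lean`, the theorem
`MultTowerAddOn.bsdp_two_<lab>_l<jJ>_of_descent` is the class file's `MultTowerClass.bsdp_two_<lab>_l<jJ>` with the universal memo binder
`hKato : ∀ W, ¬ W.HasCM → Mult W 2 → O1.KatoMultiplicativeDivisibilityRat W 2` REPLACED by the located inputs {`hne : Kato2004.nonempty_iwasawaH1Data`,
`h12 : Kato2004.thm12_4`, `hdesc : Kato2004.exists_multDivisibilityInputsDescent_nonsplit` (Literature CONSTRUCTION fact, review-accepted p486272; door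
`MultKatoRat.missingUpperBoundAt_two_nonsplit_of_towerGapMember_of_descent`, mult GEN 10 p487637),
`h15 : Greenberg1999.thm15_isTorsion_multiplicative_rat`}; every other binder is the class file's, byte for byte, and the tower-gap certificate is
the class file's own `towerGapAtTwo_<lab>_l<jJ>` (its PRINT binders `h33g`/`hM`/`hA`/`hNS2`|`hSP`/`hBDGP`, its Tate datum and its layer counts
`hlow`/`hup`/`had` pass through verbatim).
Members: 96330ba1.
HONEST FRAMING: display re-keying only — no class closes here, nothing is booked (D-0054), BSD is not proved by any of this; the tier of
`hdesc` is referee C's word (audit-1 K11-inputs sheets).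
-/

-- the Theorems namespace of this sub repeats the summit name by design (D-0017 nested layout: Summit.<S>.<Sub>)
set_option linter.dupNamespace false

noncomputable section

open scoped Classical MatrixGroups ModularForm

open NumberField IsDedekindDomain CongruenceSubgroup WeierstrassCurve Literature.NumberTheory.EllipticCurves
  Literature.NumberTheory.EllipticCurves.ModularForms Literature.NumberTheory.EllipticCurves.Rank1Residual
  Literature.NumberTheory.EllipticCurves.Rank1Residual.Typed
  Literature.NumberTheory.EllipticCurves.Rank1Residual.X11RankOneCertificates
  Literature.NumberTheory.EllipticCurves.Greenberg1999
  Summit.BirchSwinnertonDyer.Rank1Residual.X5 Summit.BirchSwinnertonDyer.Rank1Residual.X5.O1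
  Summit.BirchSwinnertonDyer.Rank1Residual.X5.Instances
  Summit.BirchSwinnertonDyer.BirchSwinnertonDyer.Theorems.KatoHalfPinch
  Summit.BirchSwinnertonDyer.BirchSwinnertonDyer.Theorems.Rank1ResidualX1Defs

namespace Summit.BirchSwinnertonDyer.BirchSwinnertonDyer.Theorems.MultTowerAddOn

open MultTowerClass

/-- `BSD(96330ba1, 2)` (class `96330ba`, NON-SPLIT at `2`, layer pair `(0,3)`): `MultTowerClass.bsdp_two_96330ba1_l03` DESCENT-KEYED — `hKato` ↦ {`hne`, `h12`, `hdesc`, `h15`};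
display = PRINT {h41ns', h41sp, hmod, hGZK, hCassels, hC, h33g, hM, hA, hNS2} + `hdesc` + `hr` + CERT {hlow, hup, had} + `hsha`. Not a booking. -/
theorem bsdp_two_96330ba1_l03_of_descent
    (hne : Kato2004.nonempty_iwasawaH1Data) (h12 : Kato2004.thm12_4)
    (hdesc : Kato2004.exists_multDivisibilityInputsDescent_nonsplit) (h15 : thm15_isTorsion_multiplicative_rat)
    (h41ns' : thm41Analogue_charValue_rankZero_numberField_anyPrime_oddLocalDegree)
    (h41sp : thm41Analogue_charValue_rankZero_split_baseChange_anyPrime) (hmod : nonempty_modularParametrizationData)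
    (hGZK : rank_eq_analyticRank_of_analyticRank_le_one) (hCassels : bsdRHS_eq_of_isIsogenous)
    (hC : cesnavicius_not_two_dvd_maninConstant_of_two_dvd_level) (h33g : lemma33_localTowerKerPrimary_eq_bot_of_good.{0})
    (hM : lemma33_localTowerKerPrimary_cyclic_of_multiplicative.{0})
    (hA : lemma33_natCard_localTowerKerPrimary_le_four_of_additive.{0})
    (hNS2 : sec3_natCard_localTowerKerPrimary_le_four_nonsplitMultiplicative_two) (hr : c96330ba1.analyticRank = 0) {a d : ℕ}
    (hlow : ∀ κ : ZpExtension ℚ 2, κ.IsCyclotomic → 2 ^ a ≤ Nat.card {z : c96330ba1.selmerLayer κ 0 // 2 • z = 0})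
    (hup : ∀ κ : ZpExtension ℚ 2, κ.IsCyclotomic → Nat.card {z : c96330ba1.selmerLayer κ 3 // 2 • z = 0} ≤ 2 ^ d)
    (had : d + 1 + 3 ≤ 7 + a) (hsha : MissingLowerBoundAt c96330ba1 2) : BSDp c96330ba1 2 :=
  bsdp_of_missingPPartAt _ 2 hGZK (hr.le.trans zero_le_one) (missingPPartAt_of_lower_of_upper _ 2 hsha
    (MultKatoRat.missingUpperBoundAt_two_nonsplit_of_towerGapMember_of_descent hne h12 hdesc h15 h41ns' h41sp hmod hGZK hCassels
      hC _ hr mult_two_96330ba1 _ (IsIsogenous.refl_holds _) nonsplit_two_96330ba1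
      (towerGapAtTwo_96330ba1_l03 h33g hM hA hNS2 hlow hup had) (Or.inl irr_two_96330ba1)))

/-- `BSD(96330ba1, 2)` (class `96330ba`, NON-SPLIT at `2`, layer pair `(1,3)`): `MultTowerClass.bsdp_two_96330ba1_l13` DESCENT-KEYED — `hKato` ↦ {`hne`, `h12`, `hdesc`, `h15`};
display = PRINT {h41ns', h41sp, hmod, hGZK, hCassels, hC, h33g, hM, hA, hNS2} + `hdesc` + `hr` + CERT {hlow, hup, had} + `hsha`. Not a booking. -/
theorem bsdp_two_96330ba1_l13_of_descent
    (hne : Kato2004.nonempty_iwasawaH1Data) (h12 : Kato2004.thm12_4)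
    (hdesc : Kato2004.exists_multDivisibilityInputsDescent_nonsplit) (h15 : thm15_isTorsion_multiplicative_rat)
    (h41ns' : thm41Analogue_charValue_rankZero_numberField_anyPrime_oddLocalDegree)
    (h41sp : thm41Analogue_charValue_rankZero_split_baseChange_anyPrime) (hmod : nonempty_modularParametrizationData)
    (hGZK : rank_eq_analyticRank_of_analyticRank_le_one) (hCassels : bsdRHS_eq_of_isIsogenous)
    (hC : cesnavicius_not_two_dvd_maninConstant_of_two_dvd_level) (h33g : lemma33_localTowerKerPrimary_eq_bot_of_good.{0})
    (hM : lemma33_localTowerKerPrimary_cyclic_of_multiplicative.{0})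
    (hA : lemma33_natCard_localTowerKerPrimary_le_four_of_additive.{0})
    (hNS2 : sec3_natCard_localTowerKerPrimary_le_four_nonsplitMultiplicative_two) (hr : c96330ba1.analyticRank = 0) {a d : ℕ}
    (hlow : ∀ κ : ZpExtension ℚ 2, κ.IsCyclotomic → 2 ^ a ≤ Nat.card {z : c96330ba1.selmerLayer κ 1 // 2 • z = 0})
    (hup : ∀ κ : ZpExtension ℚ 2, κ.IsCyclotomic → Nat.card {z : c96330ba1.selmerLayer κ 3 // 2 • z = 0} ≤ 2 ^ d)
    (had : d + 1 + 3 ≤ 6 + a) (hsha : MissingLowerBoundAt c96330ba1 2) : BSDp c96330ba1 2 :=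
  bsdp_of_missingPPartAt _ 2 hGZK (hr.le.trans zero_le_one) (missingPPartAt_of_lower_of_upper _ 2 hsha
    (MultKatoRat.missingUpperBoundAt_two_nonsplit_of_towerGapMember_of_descent hne h12 hdesc h15 h41ns' h41sp hmod hGZK hCassels
      hC _ hr mult_two_96330ba1 _ (IsIsogenous.refl_holds _) nonsplit_two_96330ba1
      (towerGapAtTwo_96330ba1_l13 h33g hM hA hNS2 hlow hup had) (Or.inl irr_two_96330ba1)))

end Summit.BirchSwinnertonDyer.BirchSwinnertonDyer.Theorems.MultTowerAddOn

end
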